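import Mathlib
import Summits.MatrixMultiplication.MatrixMultiplication.Theses.ThinBlockAlpha
import Summits.MatrixMultiplication.MatrixMultiplication.Theorems.ThinPackings.Negative.TriageRuledGraphPatternedArc

/-!
# Sketch (crux-ideate round 2, ideator 5) — crux `ThinBlockAlpha.ThinPackings` (stmt-MatrixMultiplication-10595)

Idea `toric-seed-debordering`: PER-ELEMENT potentials (Strassen monomial/toric degenerations of the abelian
group tensor in its group basis) instead of per-block labels; de-bordering in powers; slope/convex-height designs.

Contents (all statements elaborate; proofs are `sorry` unless trivial — this is an idea sketch, not a line):
* `IsToricSTPP`        — the per-element weighted STPP predicate (p q r : Fin L → H → ℤ);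
* `isToricSTPP_of_label` — the tree's `IsLabelWeightedSTPP κ μ` is the special case of CONSTANT potentials;
* `stub_toricDeborderingPower` — FIRST LEMMA of the line: popular class of (Σ p, Σ q, Σ r) + sub-leg
  restriction turns a toric family into an honest `IsSTPP` family in `Fin n → H` at polynomial loss;
* `ToricThinSeeds`, `thinPackings_of_toricThinSeeds` — the transfer C⁺ → crux;
* `schoenhage10_label` — ANCHOR: Schönhage's pair ⟨3,1,3⟩ ⊕ ⟨1,4,1⟩ is a label-weighted STPP in `ZMod 10`
  (volume 13 > 10), kernel-decided.
-/

set_option linter.dupNamespace false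

namespace Summit.MatrixMultiplication.MatrixMultiplication.Cruxes.ThinPackings.Ideator5

open Finset
open Literature.Computability.AlgebraicComplexity (IsSTPP)
open Summit.MatrixMultiplication.MatrixMultiplication.Theses.ThinBlockAlpha (ThinPackings)
open Summit.MatrixMultiplication.MatrixMultiplication.Theorems.ThinPackings.Negative.Triage2 (IsLabelWeightedSTPP)

/-- **Toric (per-element weighted) STPP.**  Blocks `(A i, B i, C i)` with honest TPP, and integer POTENTIALS
on leg elements `p i : H → ℤ` (used on `A i`), `q i` (on `B i`), `r i` (on `C i`): a cross relation
`(s' − s) + (t' − t) + (u' − u) = 0` with labels `(i, j, k)` not all equal (`s ∈ A k, s' ∈ A i, t ∈ B i,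
t' ∈ B j, u ∈ C j, u' ∈ C k`, the `IsSTPP` convention) is admissible iff its weight
`(p i s' − p k s) + (q j t' − q i t) + (r k u' − r j u) ≥ 1`.  This is exactly a monomial (toric)
degeneration of the structure tensor of `ℂ[H]` IN THE GROUP BASIS onto `⊕ᵢ ⟨|A i|, |B i|, |C i|⟩`
(weights `ξ(s'−t) = p s' − q t`, `υ(t'−u) = q t' − r u`, `ζ(s−u') = p s − r u'`); the three packings are
forced (a collision is a relation of weight `w` and `−w`). [new] -/
def IsToricSTPP {H : Type*} [AddCommGroup H] {L : ℕ} (A B C : Fin L → Finset H)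
    (p q r : Fin L → H → ℤ) : Prop :=
  (∀ i, ∀ s ∈ A i, ∀ s' ∈ A i, ∀ t ∈ B i, ∀ t' ∈ B i, ∀ u ∈ C i, ∀ u' ∈ C i,
      (s' - s) + (t' - t) + (u' - u) = 0 → s = s' ∧ t = t' ∧ u = u') ∧
  (∀ i j k : Fin L, ¬ (i = j ∧ j = k) →
      ∀ s ∈ A k, ∀ s' ∈ A i, ∀ t ∈ B i, ∀ t' ∈ B j, ∀ u ∈ C j, ∀ u' ∈ C k,
        (s' - s) + (t' - t) + (u' - u) = 0 →
          1 ≤ (p i s' - p k s) + (q j t' - q i t) + (r k u' - r j u))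

/-- The tree's label-weighted notion is the constant-potential case: `p i _ = κ i + μ i`, `q i _ = μ i`,
`r i _ = 0` gives weight `(κ i − κ k) + (μ j − μ k)` (so `κ = P − Q`, `μ = Q − R`). [new, elementary] -/
theorem isToricSTPP_of_label {H : Type*} [AddCommGroup H] {L : ℕ} {A B C : Fin L → Finset H}
    {κ μ : Fin L → ℤ} (h : IsLabelWeightedSTPP A B C κ μ) :
    IsToricSTPP A B C (fun i _ => κ i + μ i) (fun i _ => μ i) (fun _ _ => 0) := by
  obtain ⟨-, -, -, hT, hX⟩ := h
  refine ⟨hT, ?_⟩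
  intro i j k hijk s hs s' hs' t ht t' ht' u hu u' hu' hrel
  have := hX i j k hijk s hs s' hs' t ht t' ht' u hu u' hu' hrel
  dsimp only
  linarith

/-- **FIRST LEMMA (stub_toricDeborderingPower).**  Per-element de-bordering: a toric family of `L` blocks
`⟨N, M, N⟩` with potentials bounded by `R` gives, in `Fin n → H`, an honest `IsSTPP` family of `L'` blocks of
ONE shape `⟨N', M', N'⟩` with `Lⁿ ≤ L'·2K³`, `Nⁿ ≤ N'·2K³`, `Mⁿ ≤ M'·2K³`, `K = 2nR+1` (product family is toric
with summed potentials; restrict every leg to the most popular class of its potential sum — a relation inside the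
classes has total weight `0 = Σ_t Φ_t` with all `Φ_t ≥ 0`, so every coordinate is diagonal; Markov keeps
`≥ Lⁿ/2K³` blocks whose three sub-legs are each `≥ max/2K³`; trim).  Generalises the landed
`stub_deborderingPower` (per-block labels, loss `(2nR+1)²`). [new; cite: BCCGNSU 2017 Lemma 3.4 mirror] -/
theorem stub_toricDeborderingPower :
    ∀ (H : Type) [AddCommGroup H] [DecidableEq H] (L N M R : ℕ) (A B C : Fin L → Finset H)
      (p q r : Fin L → H → ℤ),
      IsToricSTPP A B C p q r → (∀ i, (A i).card = N ∧ (B i).card = M ∧ (C i).card = N) →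
      (∀ i x, |p i x| ≤ R ∧ |q i x| ≤ R ∧ |r i x| ≤ R) →
      ∀ n : ℕ, ∃ (L' N' M' : ℕ) (A' B' C' : Fin L' → Finset (Fin n → H)),
        IsSTPP A' B' C' ∧ (∀ i, (A' i).card = N' ∧ (B' i).card = M' ∧ (C' i).card = N') ∧
        L ^ n ≤ L' * (2 * (2 * n * R + 1) ^ 3) ∧ N ^ n ≤ N' * (2 * (2 * n * R + 1) ^ 3) ∧
        M ^ n ≤ M' * (2 * (2 * n * R + 1) ^ 3) := by
  sorry

/-- **C⁺ = ToricThinSeeds**: for every shape exponent `a < 1` and slack `η > 0` some finite abelian group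
carries a two-leg-tight thin TORIC family (the crux's matrix with `IsSTPP` relaxed to `IsToricSTPP`). [new] -/
def ToricThinSeeds : Prop :=
  ∀ a : ℝ, 0 ≤ a → a < 1 → ∀ η : ℝ, 0 < η → ∃ (H : Type) (_ : AddCommGroup H) (_ : Fintype H)
    (_ : DecidableEq H) (L N M : ℕ) (A B C : Fin L → Finset H) (p q r : Fin L → H → ℤ),
    IsToricSTPP A B C p q r ∧ (∀ i, (A i).card = N ∧ (B i).card = M ∧ (C i).card = N) ∧ 2 ≤ N ∧
    (N : ℝ) ^ a ≤ M ∧ (Fintype.card H : ℝ) ≤ L * (N : ℝ) ^ (2 + η)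

/-- **Transfer**: toric thin seeds give the crux (apply the seed at `(a', η/3)` with `a < a' < 1`,
de-border with `n` large: `(2·(2nR+1)³)^{O(1)} ≤ N^{nη/3}`, shrink the long legs so that `N'^{a} ≤ M'`). [new] -/
theorem thinPackings_of_toricThinSeeds (h : ToricThinSeeds) : ThinPackings := by
  sorry

/-! ## Anchor: Schönhage's pair is a label-weighted (a fortiori toric) abelian STPP with volume excess

`⟨3,1,3⟩ ⊕ ⟨1,4,1⟩` in `ZMod 10`: block 0 = (`{0,1,2}`, `{0}`, `{0,3,6}`) (a near-factorisation
`A − C = ZMod 10 ∖ {3}`), block 1 = (`{3}`, `{5,6,8,9}`, `{0}`); labels `κ = μ = (0, 1)`: the three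
patterns of negative weight, (0,0,1), (1,0,1), (0,1,1), are exactly the three packings; volume `9 + 4 = 13 > 10`.
The same recipe gives `⟨N,1,N⟩ ⊕ ⟨1,(N−1)²,1⟩` in `ZMod (N²+1)` from `A = {0..N−1}`, `C = N·{0..N−1}`
(Schönhage 1981's parameters on the nose: `B'` must avoid `(a' − A) ∪ (−C)`, `2N` points). -/

def schA : Fin 2 → Finset (ZMod 10) := ![{0, 1, 2}, {3}]
def schB : Fin 2 → Finset (ZMod 10) := ![{0}, {5, 6, 8, 9}]
def schC : Fin 2 → Finset (ZMod 10) := ![{0, 3, 6}, {0}]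
def schκ : Fin 2 → ℤ := ![0, 1]

theorem schoenhage10_label : IsLabelWeightedSTPP schA schB schC schκ schκ := by
  unfold IsLabelWeightedSTPP schA schB schC schκ
  refine ⟨by decide, by decide, by decide, by decide, ?_⟩
  intro i j k
  fin_cases i <;> fin_cases j <;> fin_cases k <;> decide

end Summit.MatrixMultiplication.MatrixMultiplication.Cruxes.ThinPackings.Ideator5
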